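import Summits.Ventures.DiscreteObjects.UnitDistance.MoserMultiquadratic

/-!
# Field planes: generic tools (cell `pub-namedobj`, target (U), seat udg g11)

Framing (verbatim for the cell): lottery ticket; floor = certified bounds/negative ranges.

Shared vocabulary for the 2-adic (`MultiquadraticCriterion`, `FieldPlanesCriterion`) and 3-adic (`ThreeAdicCriterion`)
criteria: for a subfield `K ⊆ ℝ`, `fieldPoints K = K² ⊂ ℝ²` and the restricted unit-distance graph
`planeUnitDistanceGraph.induce (fieldPoints K)` ("`χ(K²)`"); monotonicity in `K`; the trivial lower bound (an edge), the
triangle lower bound (`√3 ∈ K ⇒ χ(K²) ≥ 3`) and the Moser-spindle lower bound (`√3, √11 ∈ K ⇒ χ(K²) ≥ 4`, transported from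
udg g10's `MoserFieldPlane`); the generic IMAGE LEMMA `multiSqrtEmbed_mem_of_roots` (a `ℚ`-algebra map of `ℚ(√d : d ∈ S)`
into a field `Ω ⊇ F₀` lands in any intermediate field containing square roots of all `d ∈ S`).  Nothing here is literature.
-/

noncomputable section

namespace Summit.Ventures.DiscreteObjects.UnitDistance

open MoserLocal SimpleGraph IntermediateField Literature.Combinatorics.SimpleGraph.MoserMoser1961
open scoped IntermediateField

/-! ## The image lemma for multiquadratic fields -/

/-- IMAGE LEMMA (generic in the target): let `φ : ℚ(√d : d ∈ S) →ₐ[ℚ] Ω` be any `ℚ`-algebra map into a field `Ω` of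
characteristic zero which is an algebra over a field `F₀` (e.g. `Ω = \overline{ℚ_p}`, `F₀ = ℚ_p`).  If every `d ∈ S` has a
square root in the intermediate field `E` of `Ω/F₀`, then `φ` lands in `E`. -/
theorem multiSqrtEmbed_mem_of_roots {F₀ Ω : Type*} [Field F₀] [CharZero F₀] [Field Ω] [CharZero Ω] [Algebra F₀ Ω]
    (S : Finset ℕ) (φ : multiSqrtField S →ₐ[ℚ] Ω) (E : IntermediateField F₀ Ω)
    (hroots : ∀ d ∈ S, ∃ w ∈ E, w ^ 2 = (d : Ω)) (t : multiSqrtField S) : φ t ∈ E := by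
  obtain ⟨t, ht⟩ := t
  induction ht using IntermediateField.adjoin_induction with
  | mem y hy =>
    obtain ⟨d, hdS, rfl⟩ := hy
    have hdS' : d ∈ S := by simpa using hdS
    have hmem : Real.sqrt d ∈ multiSqrtField S := IntermediateField.subset_adjoin ℚ _ ⟨d, hdS, rfl⟩
    have hsq : (φ ⟨Real.sqrt d, hmem⟩) ^ 2 = (d : Ω) := by
      have hK : (⟨Real.sqrt d, hmem⟩ : multiSqrtField S) ^ 2 = d := by
        apply Subtype.ext
        simp [Real.sq_sqrt (Nat.cast_nonneg d)]
      rw [← map_pow, hK, map_natCast]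
    obtain ⟨w, hw, hw2⟩ := hroots d hdS'
    have h : (φ ⟨Real.sqrt d, hmem⟩) ^ 2 = w ^ 2 := by rw [hsq, hw2]
    rcases sq_eq_sq_iff_eq_or_eq_neg.1 h with h' | h'
    · rw [h']; exact hw
    · rw [h']; exact neg_mem hw
  | algebraMap q =>
    have : (⟨algebraMap ℚ ℝ q, IntermediateField.algebraMap_mem _ q⟩ : multiSqrtField S) =
        algebraMap ℚ (multiSqrtField S) q := Subtype.ext rfl
    rw [this, φ.commutes, eq_ratCast, ← map_ratCast (algebraMap F₀ Ω) q]
    exact IntermediateField.algebraMap_mem _ _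
  | add y w hy hw ihy ihw =>
    have : (⟨y + w, add_mem hy hw⟩ : multiSqrtField S) = ⟨y, hy⟩ + ⟨w, hw⟩ := rfl
    rw [this, map_add]; exact add_mem ihy ihw
  | inv y hy ihy =>
    have : (⟨y⁻¹, inv_mem hy⟩ : multiSqrtField S) = ⟨y, hy⟩⁻¹ := rfl
    rw [this, map_inv₀]; exact inv_mem ihy
  | mul y w hy hw ihy ihw =>
    have : (⟨y * w, mul_mem hy hw⟩ : multiSqrtField S) = ⟨y, hy⟩ * ⟨w, hw⟩ := rfl
    rw [this, map_mul]; exact mul_mem ihy ihw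

/-- `multiSqrtField {d} = ℚ(√d)`. -/
theorem multiSqrtField_singleton (d : ℕ) : multiSqrtField {d} = ℚ⟮Real.sqrt d⟯ := by
  simp [multiSqrtField]


/-! ## Field planes -/

/-- The points of the Euclidean plane with both coordinates in the subfield `K ⊆ ℝ` ("`K²`"). -/
def fieldPoints (K : IntermediateField ℚ ℝ) : Set (EuclideanSpace ℝ (Fin 2)) := {q | ∀ i, q i ∈ K}

/-- Membership in `fieldPoints K`. -/
theorem mem_fieldPoints_iff {K : IntermediateField ℚ ℝ} {q : EuclideanSpace ℝ (Fin 2)} :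
    q ∈ fieldPoints K ↔ ∀ i, q i ∈ K := Iff.rfl

/-- `fieldPoints` is monotone. -/
theorem fieldPoints_mono {K L : IntermediateField ℚ ℝ} (h : K ≤ L) : fieldPoints K ⊆ fieldPoints L :=
  fun _ hq i => h (hq i)

/-- `K ≤ L` ⇒ `χ(K²) ≤ χ(L²)`: a colouring of `L²` restricts to `K²`. -/
theorem colorable_plane_of_le {K L : IntermediateField ℚ ℝ} (h : K ≤ L) {n : ℕ}
    (hL : (planeUnitDistanceGraph.induce (fieldPoints L)).Colorable n) :
    (planeUnitDistanceGraph.induce (fieldPoints K)).Colorable n :=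
  hL.of_hom (planeUnitDistanceGraph.induceHomOfLE (fieldPoints_mono h)).toHom

/-- The plane restricted to `K²` is a unit-distance realisation (tautologically). -/
theorem isUnitDistanceRealisation_fieldPoints (K : IntermediateField ℚ ℝ) :
    IsUnitDistanceRealisation (planeUnitDistanceGraph.induce (fieldPoints K))
      (fun q => (q : EuclideanSpace ℝ (Fin 2))) :=
  ⟨Subtype.coe_injective, fun _ _ h => h⟩

/-- `K²` contains the unit segment `(0,0) — (1,0)`, so it is not `1`-colourable. -/
theorem not_colorable_one_plane (K : IntermediateField ℚ ℝ) :
    ¬ (planeUnitDistanceGraph.induce (fieldPoints K)).Colorable 1 := by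
  rintro ⟨C⟩
  have h0 : (!₂[(0 : ℝ), 0] : EuclideanSpace ℝ (Fin 2)) ∈ fieldPoints K := by
    intro i; fin_cases i <;> simp
  have h1 : (!₂[(1 : ℝ), 0] : EuclideanSpace ℝ (Fin 2)) ∈ fieldPoints K := by
    intro i; fin_cases i <;> simp
  have hadj : (planeUnitDistanceGraph.induce (fieldPoints K)).Adj ⟨_, h0⟩ ⟨_, h1⟩ := by
    change dist (!₂[(0 : ℝ), 0] : EuclideanSpace ℝ (Fin 2)) !₂[(1 : ℝ), 0] = 1
    have hd : dist (!₂[(0 : ℝ), 0] : EuclideanSpace ℝ (Fin 2)) !₂[(1 : ℝ), 0] ^ 2 = 1 := by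
      rw [EuclideanSpace.dist_sq_eq, Fin.sum_univ_two, Real.dist_eq, Real.dist_eq, sq_abs, sq_abs]
      norm_num
    exact (pow_eq_one_iff_of_nonneg dist_nonneg two_ne_zero).1 hd
  exact C.valid hadj (Subsingleton.elim _ _)

/-- The rational points of the plane are `fieldPoints ⊥`. -/
theorem mem_fieldPoints_bot_iff (q : EuclideanSpace ℝ (Fin 2)) :
    q ∈ fieldPoints (⊥ : IntermediateField ℚ ℝ) ↔ ∀ i, ∃ r : ℚ, (r : ℝ) = q i := by
  simp only [mem_fieldPoints_iff, IntermediateField.mem_bot, Set.mem_range, eq_ratCast]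

/-- `unitCircleGraph K` has the edge `(0,0) ~ (1,0)`, so it is not `1`-colourable. -/
theorem not_colorable_one_unitCircleGraph (K : Type*) [Field K] : ¬ (unitCircleGraph K).Colorable 1 := by
  rintro ⟨C⟩
  have hadj : (unitCircleGraph K).Adj ((0 : K), (0 : K)) ((1 : K), (0 : K)) := by
    rw [unitCircleGraph_adj]
    refine ⟨fun h => ?_, by ring⟩
    have := congrArg Prod.fst h
    exact zero_ne_one this
  exact C.valid hadj (Subsingleton.elim _ _)

/-! ## Lower bounds: triangles and the Moser spindle -/

/-- If `√3 ∈ K` then `K²` contains an equilateral unit triangle, so `χ(K²) ≥ 3`. -/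
theorem not_colorable_two_plane_of_sqrt3_mem (K : IntermediateField ℚ ℝ) (h3 : Real.sqrt 3 ∈ K) :
    ¬ (planeUnitDistanceGraph.induce (fieldPoints K)).Colorable 2 := by
  rintro ⟨C⟩
  -- the three vertices
  have hA : (!₂[(0 : ℝ), 0] : EuclideanSpace ℝ (Fin 2)) ∈ fieldPoints K := by
    intro i; fin_cases i <;> simp
  have hB : (!₂[(1 : ℝ), 0] : EuclideanSpace ℝ (Fin 2)) ∈ fieldPoints K := by
    intro i; fin_cases i <;> simp
  have hC : (!₂[(1 / 2 : ℝ), Real.sqrt 3 / 2] : EuclideanSpace ℝ (Fin 2)) ∈ fieldPoints K := by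
    intro i; fin_cases i
    · change (1 / 2 : ℝ) ∈ K; simp
    · change Real.sqrt 3 / 2 ∈ K; exact div_mem h3 (ofNat_mem K 2)
  have s3 : Real.sqrt 3 ^ 2 = 3 := Real.sq_sqrt (by norm_num)
  have hunit : ∀ (p q : EuclideanSpace ℝ (Fin 2)), (p 0 - q 0) ^ 2 + (p 1 - q 1) ^ 2 = 1 → dist p q = 1 := by
    intro p q h
    have hd : dist p q ^ 2 = 1 := by
      rw [EuclideanSpace.dist_sq_eq, Fin.sum_univ_two, Real.dist_eq, Real.dist_eq, sq_abs, sq_abs, h]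
    exact (pow_eq_one_iff_of_nonneg dist_nonneg two_ne_zero).1 hd
  have hAB : (planeUnitDistanceGraph.induce (fieldPoints K)).Adj ⟨_, hA⟩ ⟨_, hB⟩ :=
    hunit _ _ (by simp)
  have hAC : (planeUnitDistanceGraph.induce (fieldPoints K)).Adj ⟨_, hA⟩ ⟨_, hC⟩ :=
    hunit _ _ (by simp; nlinarith [s3])
  have hBC : (planeUnitDistanceGraph.induce (fieldPoints K)).Adj ⟨_, hB⟩ ⟨_, hC⟩ :=
    hunit _ _ (by simp; nlinarith [s3])
  -- three mutually adjacent vertices cannot be 2-coloured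
  have h1 := C.valid hAB
  have h2 := C.valid hAC
  have h3' := C.valid hBC
  have key : ∀ a b c : Fin 2, a ≠ b → a ≠ c → b ≠ c → False := by decide
  exact key _ _ _ h1 h2 h3'

/-- `√3, √11 ∈ K` ⇒ the Moser spindle lies in `K²`, so `χ(K²) ≥ 4` (g10's `not_colorable_three_plane_moserCoordField`
transported along `ℚ(√3, √11) ≤ K`). -/
theorem not_colorable_three_plane_of_moser (K : IntermediateField ℚ ℝ) (h3 : Real.sqrt 3 ∈ K)
    (h11 : Real.sqrt 11 ∈ K) : ¬ (planeUnitDistanceGraph.induce (fieldPoints K)).Colorable 3 := by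
  have hle : moserCoordField ≤ K := by
    rw [moserCoordField, IntermediateField.adjoin_le_iff]
    intro x hx
    simp only [Set.mem_insert_iff, Set.mem_singleton_iff] at hx
    rcases hx with rfl | rfl
    · exact h3
    · exact h11
  intro hK
  exact not_colorable_three_plane_moserCoordField (colorable_plane_of_le (K := moserCoordField) hle hK)

end Summit.Ventures.DiscreteObjects.UnitDistance
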